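import Mathlib
import Summits.MatrixMultiplication.MatrixMultiplication.Theses.ThinBlockAlpha
import Summits.MatrixMultiplication.MatrixMultiplication.Theses.RectangularAlpha
import Literature.Computability.AlgebraicComplexity.RectangularExponentBounds
import Literature.Computability.AlgebraicComplexity.GroupTheoreticMatMulProofs
import Literature.Computability.AlgebraicComplexity.AsymptoticSumInequality
import Summits.MatrixMultiplication.MatrixMultiplication.Theorems.RectangularAlphaMonotoneMiddle

/-!
# Thin abelian STPP designs certify the dual exponent (routes RectangularAlpha / ThinBlockAlpha)

The DUAL-EXPONENT READING of the thin-block designs of route ThinBlockAlpha, proved: a thin STPP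
family of `L` blocks `⟨N, M, N⟩` (`N ≥ 2`, `M ≥ N^a`) in a finite abelian group `H` with the two
long legs packed up to slack `N^η`, `|H| ≤ L · N^{2+η}`, certifies `ω_ℂ(1, 1, a) ≤ 2 + 2η`
(`omegaRect_one_one_le_of_thinDesign`).  Proof (Cohn–Kleinberg–Szegedy–Umans 2005 Thm 5.3 in rank
form + Schönhage's rectangular asymptotic sum inequality, both tree theorems): rotating the family
to shapes `⟨N, N, M⟩` keeps the STPP (`isSTPP_rotate`), so `R(⊕_{i<L} ⟨N,N,M⟩) ≤ |H|`
(`tensorRank_matMulDirectSum_le_card_of_isSTPP`); the `k`-th Kronecker power of the direct sum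
contains `L^k ⊙ ⟨N^k, N^k, M^k⟩` (`tensorRank_multiple_le_kroneckerPow_matMulDirectSum`), whence
`R(L^k ⊙ ⟨N^k,N^k,M^k⟩) ≤ |H|^k ≤ L^k · ⌈N^{k(2+η)}⌉`, and Bläser's Lemma 7.7 in rectangular form
(`rpow_omegaRect_le_of_tensorRank_multiple_le`) gives `N^{k ω(1,1,a)} ≤ ⌈N^{k(2+η)}⌉ ≤ 2N^{k(2+η)}`,
i.e. `ω(1,1,a) ≤ 2 + η + 1/k`; take `k > 1/η`.

Consequences (conditional proofs of the two items they name; no named facts):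
* `omegaRect_eq_two_of_thinDesigns` — designs for every `η > 0` at one shape `a ≥ 0` give
  `ω_ℂ(1, a, 1) = 2`;
* `dThesis_of_thinPackings : ThinBlockAlpha.ThinPackings → RectangularAlpha.DThesis` (X_thin ⇒ X_D, the
  "α = 1" reading of the route ThinBlockAlpha);
* `omegaRect_third_eq_two_of_boundedExponentThird`, `dAlphaOneThird_of_boundedExponentThird :
  ThinBlockAlpha.BoundedExponentThird → RectangularAlpha.DAlphaOneThird` (the record rung's payoff:
  `ω_ℂ(1,1/3,1) = 2`, whence `α_ℂ ≥ 1/3` by `le_dualExponentAlpha`).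

`sorry`-free; a Theorems file may import `RectangularExponentBounds` (the Theses file of ThinBlockAlpha
may not, cone repair 2026-08-15).
-/

-- `Summit.<Summit>.<Problem>` is the tree's mandated summit-side namespace; for this
-- single-conjunct summit the two coincide, so the file silences `dupNamespace`.
set_option linter.dupNamespace false

noncomputable section

open Filter Asymptotics Finset

namespace Summit.MatrixMultiplication.MatrixMultiplication.Theorems

open Literature.Computability.AlgebraicComplexity
open Summit.MatrixMultiplication.MatrixMultiplication.Theses

/-! ## Rotating an STPP family -/

/-- **The STPP is invariant under the cyclic rotation `(A, B, C) ↦ (C, A, B)`** (the defining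
relation `(s' - s) + (t' - t) + (u' - u) = 0` and its index pattern are cyclically symmetric).
[cite: CohnKleinbergSzegedyUmans2005, Def. 5.1] -/
theorem isSTPP_rotate {H : Type*} [AddCommGroup H] {L : ℕ} {A B C : Fin L → Finset H}
    (hS : IsSTPP A B C) : IsSTPP C A B := by
  intro i j k u hu u' hu' s hs s' hs' t ht t' ht' hrel
  -- the relation for `(A, B, C)` with indices `(j, k, i)`
  have h := hS j k i s hs s' hs' t ht t' ht' u hu u' hu' (by rw [← hrel]; abel)
  obtain ⟨hjk, hki, hss, htt, huu⟩ := h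
  exact ⟨hki.symm ▸ hjk ▸ hjk.symm.trans hjk, hjk, huu, hss, htt⟩

/-! ## One thin design certifies `ω(1,1,a) ≤ 2 + 2η` -/

/-- **A thin abelian STPP design certifies `ω_ℂ(1,1,a) ≤ 2 + 2η`.**  If `(A_i, B_i, C_i)_{i<L}` is
an STPP family in a finite abelian group `H` with `|A_i| = |C_i| = N ≥ 2`, `|B_i| = M ≥ N^a`
(`a ≥ 0`) and `|H| ≤ L · N^{2+η}` (`η > 0`), then `ω_ℂ(1, 1, a) ≤ 2 + 2η`.
[cite: CohnKleinbergSzegedyUmans2005, Thm. 5.3] [cite: Blaser2013, Lemma 7.7] -/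
theorem omegaRect_one_one_le_of_thinDesign {a η : ℝ} (ha : 0 ≤ a) (hη : 0 < η)
    {H : Type} [AddCommGroup H] [Fintype H] {L N M : ℕ} {A B C : Fin L → Finset H}
    (hS : IsSTPP A B C) (hc : ∀ i, (A i).card = N ∧ (B i).card = M ∧ (C i).card = N)
    (hN : 2 ≤ N) (hM : (N : ℝ) ^ a ≤ M) (hP : (Fintype.card H : ℝ) ≤ L * (N : ℝ) ^ (2 + η)) :
    omegaRect ℂ 1 1 a ≤ 2 + 2 * η := by
  classical
  -- notation and positivity
  set r : ℕ := Fintype.card H with hr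
  have hr1 : 1 ≤ r := Fintype.card_pos
  have hN0 : (0 : ℝ) < N := by exact_mod_cast (by omega : 0 < N)
  have hN1 : (1 : ℝ) < N := by exact_mod_cast (by omega : 1 < N)
  have hL : 1 ≤ L := by
    by_contra hL0
    have hL0' : L = 0 := by omega
    rw [hL0', Nat.cast_zero, zero_mul] at hP
    have : (1 : ℝ) ≤ r := by exact_mod_cast hr1
    linarith
  -- the rank bound for the rotated direct sum `⊕_{i<L} ⟨N, N, M⟩`
  have hD : tensorRank (matMulDirectSum ℂ (fun i => (C i).card) (fun i => (A i).card)
      (fun i => (B i).card)) ≤ r :=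
    tensorRank_matMulDirectSum_le_card_of_isSTPP C A B (isSTPP_rotate hS)
  -- choose the power `k > 1/η`
  obtain ⟨k, hk1, hkη⟩ : ∃ k : ℕ, 1 ≤ k ∧ 1 / (k : ℝ) ≤ η := by
    refine ⟨⌈1 / η⌉₊ + 1, by omega, ?_⟩
    have h1 : 1 / η ≤ (⌈1 / η⌉₊ : ℝ) := Nat.le_ceil _
    have h2 : (0 : ℝ) < ⌈1 / η⌉₊ + 1 := by positivity
    rw [div_le_iff₀ (by push_cast; exact h2)]
    have : 1 / η * η = 1 := by field_simp
    push_cast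
    nlinarith [mul_le_mul_of_nonneg_right h1 hη.le]
  -- `L^k ⊙ ⟨N^k, N^k, M^k⟩` sits inside the `k`-th power of the direct sum
  set rep : Fin (L ^ k) → (Fin k → Fin L) := fun β => finFunctionFinEquiv.symm β with hrep
  have hrep_inj : Function.Injective rep := fun β β' h => finFunctionFinEquiv.symm.injective h
  have hprodN : ∀ β, ∏ j, (C (rep β j)).card = N ^ k := fun β => by
    rw [Finset.prod_congr rfl (fun j _ => (hc (rep β j)).2.2), Finset.prod_const, Finset.card_univ,
      Fintype.card_fin]
  have hprodN' : ∀ β, ∏ j, (A (rep β j)).card = N ^ k := fun β => by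
    rw [Finset.prod_congr rfl (fun j _ => (hc (rep β j)).1), Finset.prod_const, Finset.card_univ,
      Fintype.card_fin]
  have hprodM : ∀ β, ∏ j, (B (rep β j)).card = M ^ k := fun β => by
    rw [Finset.prod_congr rfl (fun j _ => (hc (rep β j)).2.1), Finset.prod_const, Finset.card_univ,
      Fintype.card_fin]
  have hle : tensorRank (kroneckerTensor (unitTensor ℂ (L ^ k)) (matMulTensor ℂ (N ^ k) (N ^ k) (M ^ k)))
      ≤ r ^ k :=
    (tensorRank_multiple_le_kroneckerPow_matMulDirectSum ℂ _ _ _ rep hrep_inj hprodN hprodN' hprodM).trans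
      ((tensorRank_kroneckerPow_le _ k).trans (Nat.pow_le_pow_left hD k))
  -- the cost side: `|H|^k ≤ L^k ⌈(N^k)^{2+η}⌉`
  set x : ℝ := ((N ^ k : ℕ) : ℝ) with hx
  have hx1 : 1 < x := by
    rw [hx]; exact_mod_cast Nat.one_lt_pow (by omega) (by omega : 1 < N)
  have hx0 : 0 < x := by linarith
  have hxpow : x = (N : ℝ) ^ (k : ℝ) := by rw [hx]; push_cast; rw [Real.rpow_natCast]
  set Q : ℕ := ⌈x ^ (2 + η)⌉₊ with hQ
  have hQge : x ^ (2 + η) ≤ Q := Nat.le_ceil _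
  have hQle : (Q : ℝ) ≤ 2 * x ^ (2 + η) := by
    have h1 : (Q : ℝ) < x ^ (2 + η) + 1 := Nat.ceil_lt_add_one (Real.rpow_nonneg hx0.le _)
    have h2 : (1 : ℝ) ≤ x ^ (2 + η) := Real.one_le_rpow hx1.le (by linarith)
    linarith
  have hcost : r ^ k ≤ Q * L ^ k := by
    have h1 : ((r : ℝ)) ^ k ≤ ((L : ℝ) * (N : ℝ) ^ (2 + η)) ^ k :=
      pow_le_pow_left₀ (Nat.cast_nonneg _) hP k
    have h2 : ((L : ℝ) * (N : ℝ) ^ (2 + η)) ^ k = (L : ℝ) ^ k * x ^ (2 + η) := by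
      rw [mul_pow, hxpow, ← Real.rpow_natCast ((N : ℝ) ^ (2 + η)) k, ← Real.rpow_mul hN0.le,
        ← Real.rpow_mul hN0.le, mul_comm (2 + η) (k : ℝ)]
    have h3 : ((r ^ k : ℕ) : ℝ) ≤ ((Q * L ^ k : ℕ) : ℝ) := by
      push_cast
      rw [h2] at h1
      calc (r : ℝ) ^ k ≤ (L : ℝ) ^ k * x ^ (2 + η) := h1
        _ ≤ (L : ℝ) ^ k * Q := mul_le_mul_of_nonneg_left hQge (by positivity)
        _ = (Q : ℝ) * (L : ℝ) ^ k := by ring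
    exact_mod_cast h3
  -- Bläser's Lemma 7.7 (rectangular form): `x^{ω(1,1,a)} ≤ Q`
  have hf : 1 ≤ L ^ k := Nat.one_le_pow _ _ hL
  have ha2 : 2 ≤ N ^ k := le_trans hN (Nat.le_self_pow (by omega) N)
  have hab : ((N ^ k : ℕ) : ℝ) ^ a ≤ ((M ^ k : ℕ) : ℝ) := by
    have hM0 : (0 : ℝ) ≤ (N : ℝ) ^ a := Real.rpow_nonneg hN0.le a
    push_cast
    rw [← Real.rpow_natCast, ← Real.rpow_mul hN0.le, mul_comm, Real.rpow_mul hN0.le,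
      Real.rpow_natCast]
    exact pow_le_pow_left₀ hM0 hM k
  have h77 := rpow_omegaRect_le_of_tensorRank_multiple_le ℂ ha hf ha2 hab (hle.trans hcost)
  -- `x^{ω} ≤ 2 x^{2+η}` with `x = N^k > 1` gives `ω ≤ 2 + η + log 2 / log x ≤ 2 + 2η`
  have hω : x ^ omegaRect ℂ 1 1 a ≤ 2 * x ^ (2 + η) := h77.trans hQle
  have hlogx : 0 < Real.log x := Real.log_pos hx1
  have hlog : omegaRect ℂ 1 1 a * Real.log x ≤ Real.log 2 + (2 + η) * Real.log x := by
    have h1 := Real.log_le_log (Real.rpow_pos_of_pos hx0 _) hω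
    rw [Real.log_rpow hx0, Real.log_mul (by norm_num) (Real.rpow_pos_of_pos hx0 _).ne',
      Real.log_rpow hx0] at h1
    exact h1
  -- `log 2 / log x ≤ 1/k ≤ η` since `log x = k log N ≥ k log 2`
  have hlog2 : Real.log 2 ≤ η * Real.log x := by
    have hkx : Real.log x = k * Real.log N := by rw [hxpow, Real.log_rpow hN0]
    have hN2 : Real.log 2 ≤ Real.log N := Real.log_le_log (by norm_num) (by exact_mod_cast hN)
    have hk0 : (0 : ℝ) < k := by exact_mod_cast hk1
    have hkη' : 1 ≤ η * k := by
      rw [div_le_iff₀ hk0] at hkη; linarith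
    have hl2 : 0 < Real.log 2 := Real.log_pos (by norm_num)
    calc Real.log 2 = 1 * Real.log 2 := (one_mul _).symm
      _ ≤ (η * k) * Real.log N := mul_le_mul hkη' hN2 hl2.le (by positivity)
      _ = η * Real.log x := by rw [hkx]; ring
  have hfin : omegaRect ℂ 1 1 a * Real.log x ≤ (2 + 2 * η) * Real.log x := by nlinarith
  exact le_of_mul_le_mul_right hfin hlogx

/-! ## Designs for every slack certify `ω(1, a, 1) = 2` -/

/-- **Thin designs for every `η > 0` certify `ω_ℂ(1, a, 1) = 2`** (`a ≥ 0`).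
[cite: CohnKleinbergSzegedyUmans2005, Thm. 5.5] -/
theorem omegaRect_eq_two_of_thinDesigns {a : ℝ} (ha : 0 ≤ a)
    (h : ∀ η : ℝ, 0 < η → ∃ (H : Type) (_ : AddCommGroup H) (_ : Fintype H) (L N M : ℕ)
      (A B C : Fin L → Finset H), IsSTPP A B C ∧
      (∀ i, (A i).card = N ∧ (B i).card = M ∧ (C i).card = N) ∧ 2 ≤ N ∧ (N : ℝ) ^ a ≤ M ∧
      (Fintype.card H : ℝ) ≤ L * (N : ℝ) ^ (2 + η)) :
    omegaRect ℂ 1 a 1 = 2 := by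
  rw [omegaRect_one_mid_one]
  refine le_antisymm ?_ (two_le_omegaRect_one_one ℂ a)
  refine le_of_forall_pos_lt_add fun δ hδ => ?_
  obtain ⟨H, _, _, L, N, M, A, B, C, hS, hc, hN, hM, hP⟩ := h (δ / 4) (by positivity)
  have := omegaRect_one_one_le_of_thinDesign ha (by positivity) hS hc hN hM hP
  linarith

/-- From `ω_ℂ(1, a, 1) = 2` to the rank form `R(⟨n, ⌈n^a⌉, n⟩) = O(n^{2+ε})` for every `ε > 0`.
[cite: LeGall2012, §2 (rank form of ω(1,1,k))] -/
theorem isBigO_of_omegaRect_eq_two {a : ℝ} (h : omegaRect ℂ 1 a 1 = 2) {ε : ℝ} (hε : 0 < ε) :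
    (fun n : ℕ => (tensorRank (matMulTensor ℂ n ⌈(n : ℝ) ^ a⌉₊ n) : ℝ)) =O[atTop]
      fun n : ℕ => (n : ℝ) ^ (2 + ε) := by
  have hne : (rectAdmissibleExponents ℂ 1 a 1).Nonempty := rectAdmissibleExponents_nonempty ℂ 1 a 1
  have hlt : sInf (rectAdmissibleExponents ℂ 1 a 1) < 2 + ε := by
    change omegaRect ℂ 1 a 1 < 2 + ε
    linarith
  obtain ⟨β, hβ, hβlt⟩ := exists_lt_of_csInf_lt hne hlt
  have hmem : (2 + ε) ∈ rectAdmissibleExponents ℂ 1 a 1 := mem_rectAdmissibleExponents_of_le hβ hβlt.le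
  have hf : (fun n : ℕ =>
      (tensorRank (matMulTensor ℂ (rectDim n 1) (rectDim n a) (rectDim n 1)) : ℝ)) =
      fun n : ℕ => (tensorRank (matMulTensor ℂ n ⌈(n : ℝ) ^ a⌉₊ n) : ℝ) :=
    funext fun n => by rw [tensorRank_matMulTensor_congr ℂ (rectDim_one n) rfl (rectDim_one n)]; rfl
  simpa only [rectAdmissibleExponents, Set.mem_setOf_eq, hf] using hmem

/-! ## The two route readings -/

/-- **X_thin ⇒ X_D**: the thin-packings thesis of route ThinBlockAlpha implies the dual-exponent thesis
of route RectangularAlpha (`ω_ℂ(1, a, 1) = 2` for every `a < 1`, rank form). [folklore] -/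
theorem dThesis_of_thinPackings (h : ThinBlockAlpha.ThinPackings) : RectangularAlpha.DThesis := by
  intro a ha ε hε
  -- reduce `a < 0` to `a = 0` by monotonicity in the middle dimension
  rcases le_or_gt 0 a with ha0 | ha0
  · exact isBigO_of_omegaRect_eq_two (omegaRect_eq_two_of_thinDesigns ha0 (h a ha0 ha)) hε
  · have h0 := isBigO_of_omegaRect_eq_two (omegaRect_eq_two_of_thinDesigns le_rfl (h 0 le_rfl one_pos)) hε
    refine IsBigO.trans ?_ h0
    refine IsBigO.of_bound 1 ?_
    filter_upwards [eventually_ge_atTop 1] with n hn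
    rw [one_mul, Real.norm_of_nonneg (Nat.cast_nonneg _), Real.norm_of_nonneg (Nat.cast_nonneg _)]
    have hn1 : (1 : ℝ) ≤ n := by exact_mod_cast hn
    have hdim : ⌈(n : ℝ) ^ a⌉₊ ≤ ⌈(n : ℝ) ^ (0 : ℝ)⌉₊ :=
      Nat.ceil_mono (Real.rpow_le_rpow_of_exponent_le hn1 ha0.le)
    exact_mod_cast Literature.CplxAlg.tensorRank_matMulTensor_mono_middle ℂ n hdim

/-- **The record rung certifies `ω_ℂ(1, 1/3, 1) = 2`** (hence, by `le_dualExponentAlpha`,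
`α_ℂ ≥ 1/3 > 0.321334`, the laser-method record — the payoff of item `BoundedExponentThird`).
[cite: LeGall2012, §1] -/
theorem omegaRect_third_eq_two_of_boundedExponentThird (h : ThinBlockAlpha.BoundedExponentThird) :
    omegaRect ℂ 1 (1 / 3 : ℝ) 1 = 2 := by
  obtain ⟨ℓ, hℓ⟩ := h
  refine omegaRect_eq_two_of_thinDesigns (by norm_num) fun η hη => ?_
  obtain ⟨H, i1, i2, L, N, M, A, B, C, -, hS, hc, hN, hM, hP⟩ := hℓ η hη
  exact ⟨H, i1, i2, L, N, M, A, B, C, hS, hc, hN, hM, hP⟩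

/-- **The record rung's payoff**: `BoundedExponentThird ⇒ DAlphaOneThird` (`ω_ℂ(1, 1/3, 1) = 2` in rank
form, i.e. `R(⟨n, ⌈n^{1/3}⌉, n⟩) = O(n^{2+ε})` for every `ε > 0`). [folklore] -/
theorem dAlphaOneThird_of_boundedExponentThird (h : ThinBlockAlpha.BoundedExponentThird) :
    RectangularAlpha.DAlphaOneThird :=
  fun _ hε => isBigO_of_omegaRect_eq_two (omegaRect_third_eq_two_of_boundedExponentThird h) hε

end Summit.MatrixMultiplication.MatrixMultiplication.Theorems

end
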